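import Mathlib.RingTheory.Derivation.Basic
import Mathlib.RingTheory.Ideal.Maps
import Mathlib.RingTheory.LocalRing.MaximalIdeal.Defs

/-!
# Log-content ideals can only grow along maps with extendable log derivations

Helper file for the stub `stub_logPrincipalization` (sub-goal H1, the easy direction of the
"round lemma") of the line `pfaff-line-log-final-forms` (crux `Valuative.LuAlphaPTorsor`,
item `stmt-ResolutionOfSingularities-0641`).

Setting: `R`, `S` commutative rings (with a chosen `ℤ`-algebra structure, kept as a variable
instance because localizations carry their own), parameters `u : Fin d → R` with a boundary
`E ⊆ Fin d`, and likewise `u' : Fin d' → S`, `E' ⊆ Fin d'`. A derivation `δ ∈ Der_ℤ(R)` is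
*`E`-logarithmic* when `δ (u i) ∈ (u i)` for every `i ∈ E`. The **log-content ideal** of
`a : R` is

  `C_E(a; R) := Ideal.span {δ a | δ ∈ Der_ℤ(R) E-logarithmic}`.

* `content_map_le_of_forall_exists_extension` — if along `φ : R →+* S` every `E`-logarithmic
  derivation `δ` of `R` extends to an `E'`-logarithmic derivation `δ'` of `S`
  (`δ' ∘ φ = φ ∘ δ`), then `C_E(a; R) · S ≤ C_{E'}(φ a; S)`: the extended ideal is generated by
  the `φ (δ a) = δ' (φ a)`, which are generators of the target. [folklore]
-/

set_option linter.dupNamespace false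

namespace Summit.ResolutionOfSingularities.ResolutionOfSingularities.Theorems.PfaffLine

open IsLocalRing

/-- **Log-content can only grow** (sub-goal H1 of `stub_logPrincipalization`, easy half of the
round lemma). If every `E`-logarithmic `ℤ`-derivation `δ` of `R` extends along `φ : R →+* S` to an
`E'`-logarithmic derivation `δ'` of `S` with `δ' (φ x) = φ (δ x)`, then the extension to `S` of the
log-content ideal `C_E(a; R) = span {δ a}` is contained in `C_{E'}(φ a; S) = span {δ' (φ a)}`.
Proof: `Ideal.map_span` + `Ideal.span_le`; a generator `φ (δ a)` equals `δ' (φ a)` for the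
extension `δ'` of `δ`, a generator of the target (`Ideal.subset_span`). [folklore] -/
theorem content_map_le_of_forall_exists_extension : ∀ {R S : Type*} [CommRing R] [CommRing S] [Algebra ℤ R] [Algebra ℤ S] (φ : R →+* S) (a : R) {d d' : ℕ} (u : Fin d → R) (E : Finset (Fin d)) (u' : Fin d' → S) (E' : Finset (Fin d')), (∀ δ : Derivation ℤ R R, (∀ i ∈ E, δ (u i) ∈ Ideal.span {u i}) → ∃ δ' : Derivation ℤ S S, (∀ i ∈ E', δ' (u' i) ∈ Ideal.span {u' i}) ∧ ∀ x, δ' (φ x) = φ (δ x)) → (Ideal.span {b | ∃ δ : Derivation ℤ R R, (∀ i ∈ E, δ (u i) ∈ Ideal.span {u i}) ∧ δ a = b}).map φ ≤ Ideal.span {b | ∃ δ' : Derivation ℤ S S, (∀ i ∈ E', δ' (u' i) ∈ Ideal.span {u' i}) ∧ δ' (φ a) = b} := by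
  intro R S _ _ _ _ φ a d d' u E u' E' hext
  rw [Ideal.map_span, Ideal.span_le]
  rintro _ ⟨b, ⟨δ, hδ, rfl⟩, rfl⟩
  obtain ⟨δ', hδ', hcomm⟩ := hext δ hδ
  exact Ideal.subset_span ⟨δ', hδ', hcomm a⟩

end Summit.ResolutionOfSingularities.ResolutionOfSingularities.Theorems.PfaffLine
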